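import Summits.CriticalPhenomena.CardyFormulaZ2.Theses.CardySelfRefinement
import Literature.Probability.RandomPlanarGeometry.SLEUniquenessInLaw

/-!
# `SubseqUpgrade` (stmt-CriticalPhenomena-10279), negative side: the subsequence principle needs
# uniqueness of the limit law, and nothing else

Negative-side support for the crux `CardySelfRefinement.SubseqUpgrade` (cdisprove unit
refuter-cdisprove-stmt-CriticalPhenomena-10279-0). The crux is NOT refuted — it is a theorem
(prover-ready proof attached to the item as evidence `Proof.lean`; see also
`Cruxes/SubseqUpgrade/Disproof.lean`). This file records, sorry-free and definition-free, what
any proof must use. Write `SP(S, g)` for the abstract subsequence principle "every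
everywhere-positive null sequence of meshes has a subsequence along which `g` tends to a point of
`S` ⇒ `g` tends along `𝓝[>] 0` to a point of `S`" (inlined in each statement below):

* `subseq_principle_of_subsingleton` — `SP(S, g)` holds when the target set `S` is a
  subsingleton (for the crux: the chordal SLE₆ laws of one Dobrushin domain, a singleton by
  `IsSLELaw.unique'`);
* `not_subseq_principle_pair` — `SP({0,1}, g)` FAILS for `g` the indicator of the mesh set
  `{1/(n+1)}` (`indicator_mesh`, `indicator_offmesh`): identification of the subsequential
  limits up to uniqueness is the load-bearing hypothesis;
* `convergesInLawToSLE_of_subseq` — the general criterion behind the crux, for arbitrary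
  configuration spaces: eventual a.e.-measurability + per-sequence subsequential convergence of
  the laws to SOME chordal SLE_κ law of `(D; a, b)` ⇒ `ConvergesInLawToSLE κ D X P`; neither
  tightness, nor `StrictMono` subsequences, nor one subsequence serving all domains is needed.
-/

noncomputable section

namespace Summit.CriticalPhenomena.CardyFormulaZ2.Theorems.SubseqUpgrade.Negative

open Filter MeasureTheory Topology
open scoped NNReal
open Literature.Probability.RandomPlanarGeometry

/-! ## The abstract subsequence principle -/

/-- A sequence tending to `0` within `(0, ∞)` agrees eventually with an everywhere-positive null
sequence. [folklore] -/
theorem exists_pos_seq_eventuallyEq {ns : ℕ → ℝ} (hns : Tendsto ns atTop (𝓝[>] (0 : ℝ))) :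
    ∃ δs : ℕ → ℝ, (∀ n, 0 < δs n) ∧ Tendsto δs atTop (𝓝 0) ∧ δs =ᶠ[atTop] ns := by
  have hns0 : Tendsto ns atTop (𝓝 0) := (tendsto_nhdsWithin_iff.1 hns).1
  have hpos : ∀ᶠ n in atTop, 0 < ns n := (tendsto_nhdsWithin_iff.1 hns).2
  refine ⟨fun n => if 0 < ns n then ns n else 1 / ((n : ℝ) + 1), fun n => ?_, ?_, ?_⟩
  · by_cases h : 0 < ns n
    · simp [h]
    · simp only [if_neg h]; positivity
  · refine hns0.congr' (hpos.mono fun n hn => ?_)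
    simp [hn]
  · exact hpos.mono fun n hn => by simp [hn]

/-- **The subsequence principle holds for a subsingleton target set** `S`: if every
everywhere-positive null sequence of meshes has a subsequence along which `g` tends to a point of
`S`, then `g` tends along `𝓝[>] 0` to a point of `S`. Billingsley (1999), Thm. 2.6. [folklore] -/
theorem subseq_principle_of_subsingleton {α : Type*} [TopologicalSpace α] {S : Set α}
    (hS : S.Subsingleton) (g : ℝ → α)
    (h : ∀ δs : ℕ → ℝ, (∀ n, 0 < δs n) → Tendsto δs atTop (𝓝 0) →
      ∃ φ : ℕ → ℕ, StrictMono φ ∧ ∃ a ∈ S, Tendsto (fun n => g (δs (φ n))) atTop (𝓝 a)) :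
    ∃ a ∈ S, Tendsto g (𝓝[>] (0 : ℝ)) (𝓝 a) := by
  obtain ⟨-, -, a, ha, -⟩ := h (fun n => 1 / ((n : ℝ) + 1)) (fun n => by positivity)
    tendsto_one_div_add_atTop_nhds_zero_nat
  refine ⟨a, ha, tendsto_of_subseq_tendsto fun ns hns => ?_⟩
  obtain ⟨δs, hδpos, hδlim, hδeq⟩ := exists_pos_seq_eventuallyEq hns
  obtain ⟨φ, hφ, b, hb, hconv⟩ := h δs hδpos hδlim
  obtain rfl : b = a := hS hb ha
  exact ⟨φ, hconv.congr' ((hφ.tendsto_atTop.eventually hδeq).mono fun n hn => by rw [hn])⟩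

/-- On the mesh set `{1/(n+1)}` its indicator is `1`. [folklore] -/
theorem indicator_mesh (n : ℕ) :
    Set.indicator (Set.range fun m : ℕ => 1 / ((m : ℝ) + 1)) (1 : ℝ → ℝ) (1 / ((n : ℝ) + 1)) = 1 := by
  rw [Set.indicator_of_mem (Set.mem_range_self n)]
  rfl

/-- On the shifted set `{1/(n+3/2)}` (disjoint from the mesh set by parity) the indicator of the
mesh set is `0`. [folklore] -/
theorem indicator_offmesh (n : ℕ) :
    Set.indicator (Set.range fun m : ℕ => 1 / ((m : ℝ) + 1)) (1 : ℝ → ℝ) (1 / ((n : ℝ) + 3 / 2))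
      = 0 := by
  rw [Set.indicator_of_notMem]
  rintro ⟨m, hm⟩
  have h1 : (0 : ℝ) < (m : ℝ) + 1 := by positivity
  have h2 : (0 : ℝ) < (n : ℝ) + 3 / 2 := by positivity
  have h : (m : ℝ) + 1 = (n : ℝ) + 3 / 2 := by
    have := hm
    field_simp at this
    linarith
  have h' : (2 * m + 2 : ℝ) = 2 * n + 3 := by linarith
  norm_cast at h'
  omega

/-- **Uniqueness of the limit is load-bearing**: with the two-point target `{0, 1}` the
subsequence principle fails — for `g` the indicator of the mesh set `{1/(n+1)}` every sequence has
a subsequence on which `g` is constant (`0` or `1`), yet `g` has no limit at `0⁺` (test along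
`1/(n+1)` and `1/(n+3/2)`). Hence any proof of `SubseqUpgrade` must use that two chordal SLE₆ laws
of the same Dobrushin domain coincide (`IsSLELaw.unique'`). [folklore] -/
theorem not_subseq_principle_pair :
    ¬ ∀ g : ℝ → ℝ, (∀ δs : ℕ → ℝ, (∀ n, 0 < δs n) → Tendsto δs atTop (𝓝 0) →
        ∃ φ : ℕ → ℕ, StrictMono φ ∧ ∃ a ∈ ({0, 1} : Set ℝ),
          Tendsto (fun n => g (δs (φ n))) atTop (𝓝 a)) →
      ∃ a ∈ ({0, 1} : Set ℝ), Tendsto g (𝓝[>] (0 : ℝ)) (𝓝 a) := by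
  intro hall
  have h := hall (Set.indicator (Set.range fun m : ℕ => 1 / ((m : ℝ) + 1)) (1 : ℝ → ℝ))
  have hyp : ∀ δs : ℕ → ℝ, (∀ n, 0 < δs n) → Tendsto δs atTop (𝓝 0) →
      ∃ φ : ℕ → ℕ, StrictMono φ ∧ ∃ a ∈ ({0, 1} : Set ℝ),
        Tendsto (fun n => Set.indicator (Set.range fun m : ℕ => 1 / ((m : ℝ) + 1)) (1 : ℝ → ℝ)
          (δs (φ n))) atTop (𝓝 a) := by
    intro δs _ _
    by_cases hf : ∃ᶠ n in atTop, δs n ∈ Set.range fun m : ℕ => 1 / ((m : ℝ) + 1)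
    · obtain ⟨φ, hφ, hφ'⟩ := extraction_of_frequently_atTop hf
      refine ⟨φ, hφ, 1, by simp, ?_⟩
      have : (fun n => Set.indicator (Set.range fun m : ℕ => 1 / ((m : ℝ) + 1)) (1 : ℝ → ℝ)
          (δs (φ n))) = fun _ => 1 := funext fun n => by
        rw [Set.indicator_of_mem (hφ' n)]
        rfl
      rw [this]
      exact tendsto_const_nhds
    · obtain ⟨φ, hφ, hφ'⟩ := extraction_of_eventually_atTop (not_frequently.1 hf)
      refine ⟨φ, hφ, 0, by simp, ?_⟩
      have : (fun n => Set.indicator (Set.range fun m : ℕ => 1 / ((m : ℝ) + 1)) (1 : ℝ → ℝ)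
          (δs (φ n))) = fun _ => 0 := funext fun n => by
        rw [Set.indicator_of_notMem (hφ' n)]
      rw [this]
      exact tendsto_const_nhds
  obtain ⟨a, -, hlim⟩ := h hyp
  have hseq1 : Tendsto (fun n : ℕ => 1 / ((n : ℝ) + 1)) atTop (𝓝[>] (0 : ℝ)) :=
    tendsto_nhdsWithin_iff.2 ⟨tendsto_one_div_add_atTop_nhds_zero_nat,
      Eventually.of_forall fun n => Set.mem_Ioi.2 (by positivity)⟩
  have h1 := hlim.comp hseq1
  have h1' : ((Set.indicator (Set.range fun m : ℕ => 1 / ((m : ℝ) + 1)) (1 : ℝ → ℝ)) ∘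
      fun n : ℕ => 1 / ((n : ℝ) + 1)) = fun _ => 1 :=
    funext fun n => indicator_mesh n
  rw [h1'] at h1
  have ha1 : a = 1 := tendsto_nhds_unique h1 tendsto_const_nhds ▸ rfl
  have hseq0 : Tendsto (fun n : ℕ => 1 / ((n : ℝ) + 3 / 2)) atTop (𝓝[>] (0 : ℝ)) := by
    refine tendsto_nhdsWithin_iff.2 ⟨?_, Eventually.of_forall fun n => Set.mem_Ioi.2 (by positivity)⟩
    have : Tendsto (fun n : ℕ => (n : ℝ) + 3 / 2) atTop atTop :=
      tendsto_atTop_add_const_right _ _ tendsto_natCast_atTop_atTop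
    exact tendsto_const_nhds.div_atTop this
  have h0 := hlim.comp hseq0
  have h0' : ((Set.indicator (Set.range fun m : ℕ => 1 / ((m : ℝ) + 1)) (1 : ℝ → ℝ)) ∘
      fun n : ℕ => 1 / ((n : ℝ) + 3 / 2)) = fun _ => 0 :=
    funext fun n => indicator_offmesh n
  rw [h0'] at h0
  have ha0 : a = 0 := tendsto_nhds_unique h0 tendsto_const_nhds ▸ rfl
  exact one_ne_zero (ha1.symm.trans ha0)

/-! ## The general criterion behind the crux -/

/-- **Convergence in law to chordal SLE_κ from subsequential identification alone** (general
configuration spaces): eventual a.e.-measurability plus "every everywhere-positive null sequence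
of meshes has a subsequence (`Tendsto φ atTop atTop` suffices) along which the laws of `X` converge
to SOME chordal SLE_κ law of `(D; a, b)`" gives `ConvergesInLawToSLE κ D X P`. No tightness
hypothesis and no single subsequence for all domains are needed: uniqueness of the SLE_κ law
(`IsSLELaw.eq_map_of_isSLECurve`) and `tendsto_of_subseq_tendsto` on `𝓝[>] 0`.
Billingsley (1999), Thm. 2.6; Lawler (2005), §6.3. [folklore] -/
theorem convergesInLawToSLE_of_subseq {Ωδ : ℝ → Type*} [∀ δ, MeasurableSpace (Ωδ δ)]
    {κ : ℝ≥0} {D : DobrushinDomain} {X : ∀ δ, Ωδ δ → CurveClass ℂ} {P : ∀ δ, Measure (Ωδ δ)}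
    (hX : ∀ᶠ δ in 𝓝[>] (0 : ℝ), AEMeasurable (X δ) (P δ))
    (hsub : ∀ δs : ℕ → ℝ, (∀ n, 0 < δs n) → Tendsto δs atTop (𝓝 0) →
      ∃ φ : ℕ → ℕ, Tendsto φ atTop atTop ∧ ∃ μ : Measure (CurveClass ℂ), IsSLELaw κ D μ ∧
        ∀ f : BoundedContinuousFunction (CurveClass ℂ) ℝ,
          Tendsto (fun n => ∫ ω, f (X (δs (φ n)) ω) ∂(P (δs (φ n)))) atTop (𝓝 (∫ γ, f γ ∂μ))) :
    ConvergesInLawToSLE κ D X P := by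
  obtain ⟨-, -, μ₀, hμ₀, -⟩ := hsub (fun n => 1 / ((n : ℝ) + 1)) (fun n => by positivity)
    tendsto_one_div_add_atTop_nhds_zero_nat
  obtain ⟨Γ, hΓ, -⟩ := hμ₀
  refine ⟨Γ, hΓ, hX, fun f => tendsto_of_subseq_tendsto fun ns hns => ?_⟩
  obtain ⟨δs, hδpos, hδlim, hδeq⟩ := exists_pos_seq_eventuallyEq hns
  obtain ⟨φ, hφ, μ, hμ, hconv⟩ := hsub δs hδpos hδlim
  have hμΓ : μ = Literature.Probability.Process.preWienerMeasure.map Γ := hμ.eq_map_of_isSLECurve hΓ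
  refine ⟨φ, ?_⟩
  have h1 := hconv f
  rw [hμΓ, integral_map hΓ.aemeasurable f.continuous.aestronglyMeasurable] at h1
  exact h1.congr' ((hφ.eventually hδeq).mono fun n hn =>
    congrArg (fun δ => ∫ ω, f (X δ ω) ∂(P δ)) hn)

end Summit.CriticalPhenomena.CardyFormulaZ2.Theorems.SubseqUpgrade.Negative
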